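import Mathlib.Algebra.DualNumber
import Mathlib.RingTheory.Ideal.Cotangent
import Mathlib.LinearAlgebra.Dual.Lemmas
import Mathlib.FieldTheory.Finiteness
import Mathlib.RingTheory.LocalRing.ResidueField.Basic
import Mathlib.Algebra.Module.SpanRankOperations
import Literature.RingTheory.CompleteIntersection.CongruenceModule
import HarnessLib

/-!
# `k[ε]`-points of an augmented `k`-algebra: the tangent space is dual to `I/I²`
# (Mazur §15; Böckle Thm. 2.2 (a))

Topic `Literature/RingTheory/CompleteLocalRings`.  Let `k` be a field and `(A, π)` an augmented
`k`-algebra (`π : A →ₐ[k] k`), `I = ker π`.  The **tangent space** of `(A, π)` is the set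
`t_A = {φ : A →ₐ[k] k[ε] | φ ≡ π mod ε}` of `k[ε]`-valued points lifting `π` (Mazur's
`t_R = Hom_Λ(R, k[ε])`, [Maz97, §15]; Böckle's `t_R := F(k[ε])`, [Böc07, p. 26]).  We PROVE the
classical duality

* `TangentHom.equivDual` — `t_A ≃ Hom_k(I/I², k)` (`φ ↦ (x ↦ ε`-part of `φ(x))`, inverse
  `ℓ ↦ (a ↦ π(a) + ℓ[a − π(a)] ε)`), [Maz97, §15 Prop.], [Böc07, Thm. 2.2 (a) and its proof:
  "`t_R ≅ Hom(𝔪_R/(𝔪_R² + 𝔪_𝒪 R), k)`"] — here in the absolute case `Λ = k`, to which the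
  relative case reduces by passing to `R/𝔪_Λ R`;
* `TangentHom.finite_cotangent`, `TangentHom.natCard_eq` — for `A` Noetherian, `I/I²` is a
  finite-dimensional `k`-space and, for `k` finite, `#t_A = #k ^ dim_k I/I²`;
* `TangentHom.finrank_cotangentSpace_eq_spanFinrank`, `TangentHom.natCard_eq_pow_spanFinrank` —
  for `A` local Noetherian (so `I = 𝔪_A`): `dim_k t_A = dim_k 𝔪_A/𝔪_A² = μ(𝔪_A)`, the minimal
  number of generators of `𝔪_A` (Nakayama, Mathlib
  `IsLocalRing.spanFinrank_maximalIdeal_eq_finrank_cotangentSpace`), i.e.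
  `#t_A = #k ^ μ(𝔪_A)`.

Everything is proved; no named facts.

## References

* B. Mazur, *An introduction to the deformation theory of Galois representations*, in Modular
  Forms and Fermat's Last Theorem (Springer 1997), §15 (Zariski tangent space) and §17.
  [cite: Mazur1997Deformation, §15]
* G. Böckle, *Presentations of universal deformation rings*, LMS LNS 320 (2007), Thm. 2.2 (a).
  [cite: Bockle2007Presentations, Theorem 2.2]
-/

noncomputable section

namespace Literature.RingTheory.CompleteLocalRings

open TrivSqZeroExt DualNumber IsLocalRing

universe u v

variable {k : Type u} [Field k] {A : Type v} [CommRing A] [Algebra k A] (π : A →ₐ[k] k)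

/-- **The tangent space of an augmented `k`-algebra** `(A, π)`: the `k`-algebra maps
`A → k[ε]` lifting `π` (Mazur's `t_R = Hom(R, k[ε])`). [cite: Mazur1997Deformation, §15] -/
def TangentHom : Type (max u v) :=
  {φ : A →ₐ[k] k[ε] // ∀ a, (φ a).fst = π a}

namespace TangentHom

variable {π}

/-- Projection of `A` onto the augmentation ideal along `k`: `a ↦ a − π(a)`. [folklore] -/
def proj (π : A →ₐ[k] k) : A →ₗ[k] ↥(RingHom.ker π) where
  toFun a := ⟨a - algebraMap k A (π a), by
    rw [RingHom.mem_ker]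
    change π (a - algebraMap k A (π a)) = 0
    rw [map_sub, AlgHom.commutes, Algebra.algebraMap_self, RingHom.id_apply, sub_self]⟩
  map_add' a b := by
    ext
    simp only [map_add, Submodule.coe_add]
    ring
  map_smul' c a := by
    ext
    simp only [RingHom.id_apply, Algebra.smul_def, map_mul, Submodule.coe_smul_of_tower,
      AlgHom.commutes, Algebra.algebraMap_self]
    ring

/-- `proj a = a − π(a)` in `A`. [folklore] -/
@[simp] theorem coe_proj (a : A) : (proj π a : A) = a - algebraMap k A (π a) := rfl

/-- `proj` is the identity on the augmentation ideal. [folklore] -/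
theorem proj_of_mem (x : ↥(RingHom.ker π)) : proj π x = x := by
  ext
  rw [coe_proj]
  have hx : π x = 0 := x.2
  rw [hx, map_zero, sub_zero]

/-- `proj` kills `k`. [folklore] -/
theorem proj_algebraMap (c : k) : proj π (algebraMap k A c) = 0 := by
  ext
  rw [coe_proj, AlgHom.commutes, Algebra.algebraMap_self, RingHom.id_apply, sub_self]
  rfl

/-- The `ε`-part of a tangent vector, restricted to the augmentation ideal. [folklore] -/
def sndRestrict (φ : TangentHom π) : ↥(RingHom.ker π) →ₗ[k] k where
  toFun x := (φ.1 x).snd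
  map_add' x y := by simp
  map_smul' c x := by
    change (φ.1 ((c • x : ↥(RingHom.ker π)) : A)).snd = c • (φ.1 x).snd
    rw [Submodule.coe_smul_of_tower, Algebra.smul_def, map_mul, AlgHom.commutes,
      TrivSqZeroExt.algebraMap_eq_inl', Algebra.algebraMap_self, RingHom.id_apply,
      TrivSqZeroExt.snd_mul, fst_inl, snd_inl, smul_zero, add_zero]

/-- Unfolding lemma for `sndRestrict`. [folklore] -/
@[simp] theorem sndRestrict_apply (φ : TangentHom π) (x : ↥(RingHom.ker π)) :
    φ.sndRestrict x = (φ.1 x).snd := rfl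

/-- On the augmentation ideal a tangent vector has no constant part. [folklore] -/
theorem fst_apply_of_mem (φ : TangentHom π) (x : ↥(RingHom.ker π)) : (φ.1 x).fst = 0 := by
  rw [φ.2]
  exact x.2

/-- The `ε`-part of a tangent vector vanishes on `I²`. [folklore] -/
theorem sndRestrict_mul (φ : TangentHom π) (x y : ↥(RingHom.ker π)) :
    φ.sndRestrict (x * y) = 0 := by
  rw [sndRestrict_apply]
  change (φ.1 ((x : A) * y)).snd = 0
  rw [map_mul, TrivSqZeroExt.snd_mul, fst_apply_of_mem, fst_apply_of_mem, zero_smul,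
    MulOpposite.op_zero, zero_smul, add_zero]

/-- **Tangent vector ↦ linear form on `I/I²`.** [cite: Mazur1997Deformation, §15] -/
def toDual (φ : TangentHom π) : Module.Dual k (RingHom.ker π).Cotangent :=
  Ideal.Cotangent.lift φ.sndRestrict φ.sndRestrict_mul

/-- `toDual φ [x] = ε`-part of `φ(x)`. [folklore] -/
@[simp] theorem toDual_toCotangent (φ : TangentHom π) (x : ↥(RingHom.ker π)) :
    φ.toDual ((RingHom.ker π).toCotangent x) = (φ.1 x).snd := rfl

/-- The Leibniz identity behind the inverse construction: in `I/I²`,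
`[ab − π(ab)] = π(a)[b − π(b)] + π(b)[a − π(a)]`. [folklore] -/
theorem toCotangent_proj_mul (a b : A) :
    (RingHom.ker π).toCotangent (proj π (a * b)) =
      π a • (RingHom.ker π).toCotangent (proj π b) +
        π b • (RingHom.ker π).toCotangent (proj π a) := by
  have key : proj π (a * b) = algebraMap k A (π a) • proj π b + algebraMap k A (π b) • proj π a +
      proj π a * proj π b := by
    ext
    simp only [Submodule.coe_add, Submodule.coe_smul, smul_eq_mul, coe_proj, map_mul]
    change _ = _ + (a - algebraMap k A (π a)) * (b - algebraMap k A (π b))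
    ring
  have hsq : (RingHom.ker π).toCotangent (proj π a * proj π b) = 0 := by
    rw [Ideal.toCotangent_eq_zero, pow_two]
    exact Ideal.mul_mem_mul (proj π a).2 (proj π b).2
  rw [key, map_add, map_add, map_smul, map_smul, algebraMap_smul, algebraMap_smul, hsq, add_zero]

/-- **Linear form on `I/I²` ↦ tangent vector**: `a ↦ π(a) + ℓ[a − π(a)]·ε`.
[cite: Mazur1997Deformation, §15] -/
def ofDual (ℓ : Module.Dual k (RingHom.ker π).Cotangent) : TangentHom π :=
  ⟨{ toFun := fun a => inl (π a) + inr (ℓ ((RingHom.ker π).toCotangent (proj π a)))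
     map_one' := by
       have h1 : proj π (1 : A) = 0 := by
         rw [← (algebraMap k A).map_one]
         exact proj_algebraMap 1
       rw [map_one, h1, map_zero, map_zero, inr_zero, add_zero]
       rfl
     map_mul' := fun a b => by
       refine TrivSqZeroExt.ext ?_ ?_
       · simp only [fst_add, fst_inl, fst_inr, add_zero, TrivSqZeroExt.fst_mul, map_mul]
       · simp only [snd_add, snd_inl, snd_inr, zero_add, TrivSqZeroExt.snd_mul, fst_add, fst_inl,
           fst_inr, add_zero, toCotangent_proj_mul, map_add, map_smul, smul_eq_mul,
           MulOpposite.smul_eq_mul_unop, MulOpposite.unop_op]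
         ring
     map_zero' := by
       rw [map_zero, map_zero, map_zero, map_zero, inl_zero, inr_zero, add_zero]
     map_add' := fun a b => by
       refine TrivSqZeroExt.ext ?_ ?_
       · simp only [fst_add, fst_inl, fst_inr, add_zero, map_add]
       · simp only [snd_add, snd_inl, snd_inr, zero_add, map_add]
     commutes' := fun c => by
       rw [AlgHom.commutes, proj_algebraMap, map_zero, map_zero, inr_zero, add_zero]
       rfl },
    fun a => by simp⟩

/-- Unfolding lemma for `ofDual`. [folklore] -/
theorem ofDual_apply (ℓ : Module.Dual k (RingHom.ker π).Cotangent) (a : A) :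
    (ofDual ℓ).1 a = inl (π a) + inr (ℓ ((RingHom.ker π).toCotangent (proj π a))) := rfl

/-- **The tangent space is dual to `I/I²`** (Mazur §15; Böckle Thm. 2.2 (a)):
`t_A = {φ : A → k[ε] lifting π} ≃ Hom_k(I/I², k)`, `I = ker π`.
[cite: Mazur1997Deformation, §15] [cite: Bockle2007Presentations, Theorem 2.2] -/
def equivDual : TangentHom π ≃ Module.Dual k (RingHom.ker π).Cotangent where
  toFun := toDual
  invFun := ofDual
  left_inv φ := by
    refine Subtype.ext (AlgHom.ext fun a => ?_)
    rw [ofDual_apply, toDual_toCotangent]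
    have h1 : (φ.1 (proj π a : A)).snd = (φ.1 a).snd := by
      rw [coe_proj, map_sub, AlgHom.commutes, snd_sub]
      change (φ.1 a).snd - (inl (π a) : k[ε]).snd = (φ.1 a).snd
      rw [snd_inl, sub_zero]
    rw [h1, ← φ.2 a, inl_fst_add_inr_snd_eq]
  right_inv ℓ := by
    refine LinearMap.ext fun v => ?_
    obtain ⟨x, rfl⟩ := (RingHom.ker π).toCotangent_surjective v
    rw [toDual_toCotangent, ofDual_apply, snd_add, snd_inl, snd_inr, zero_add, proj_of_mem]

/-! ## Counting: `#t_A = #k ^ dim_k I/I²` -/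

/-- For Noetherian `A`, the cotangent module `I/I²` of the augmentation ideal is a
finite-dimensional `k`-space (generators of `I` over `A` span `I/I²` over `k`, since `I` acts
trivially and `A = k + I`). [folklore] -/
theorem finite_cotangent [IsNoetherianRing A] : Module.Finite k (RingHom.ker π).Cotangent := by
  set I : Ideal A := RingHom.ker π with hI
  haveI : Module.Finite A I.Cotangent :=
    Module.Finite.of_surjective I.toCotangent I.toCotangent_surjective
  obtain ⟨s, hs⟩ := (inferInstance : Module.Finite A I.Cotangent).fg_top
  refine ⟨⟨s, ?_⟩⟩
  apply le_antisymm le_top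
  -- the `A`-span of `s` is everything; reduce `A`-combinations to `k`-combinations
  have key : ∀ v ∈ Submodule.span A (s : Set I.Cotangent), v ∈ Submodule.span k (s : Set I.Cotangent) := by
    intro v hv
    refine Submodule.span_induction (fun x hx => Submodule.subset_span hx) (Submodule.zero_mem _)
      (fun x y _ _ hx hy => Submodule.add_mem _ hx hy) (fun a x _ hx => ?_) hv
    have ha : a • x = π a • x := by
      have h1 : a = algebraMap k A (π a) + (proj π a : A) := by rw [coe_proj]; ring
      conv_lhs => rw [h1]
      rw [add_smul, algebraMap_smul, Ideal.Cotangent.smul_eq_zero_of_mem (proj π a).2, add_zero]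
    rw [ha]
    exact Submodule.smul_mem _ _ hx
  intro v _
  exact key v (hs ▸ Submodule.mem_top)

/-- **`#t_A = #k ^ dim_k I/I²`** for `k` finite and `A` Noetherian. [cite: Mazur1997Deformation, §15] -/
theorem natCard_eq [Finite k] [IsNoetherianRing A] :
    Nat.card (TangentHom π) = Nat.card k ^ Module.finrank k (RingHom.ker π).Cotangent := by
  haveI := finite_cotangent (π := π)
  rw [Nat.card_congr (equivDual (π := π)), Module.natCard_eq_pow_finrank (K := k),
    Subspace.dual_finrank_eq]

/-! ## The local case: `dim_k t_A = μ(𝔪_A)` -/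

section Local

variable [IsLocalRing A] (π)

/-- For a local augmented `k`-algebra the augmentation ideal is the maximal ideal. [folklore] -/
theorem ker_eq_maximalIdeal : RingHom.ker π = maximalIdeal A :=
  IsLocalRing.eq_maximalIdeal (RingHom.ker_isMaximal_of_surjective π
    (Literature.RingTheory.CompleteIntersection.augmentation_surjective π))

/-- The `k`-action on the cotangent space of a local `k`-algebra factors through the residue
field. [folklore] -/
theorem isScalarTower_residueField_cotangentSpace :
    IsScalarTower k (ResidueField A) (CotangentSpace A) := by
  refine ⟨fun c x v => ?_⟩
  obtain ⟨r, rfl⟩ := IsLocalRing.residue_surjective x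
  have h2 : ∀ r : A, (IsLocalRing.residue A r) • v = r • v :=
    fun r => algebraMap_smul (ResidueField A) r v
  have h1 : c • IsLocalRing.residue A r = IsLocalRing.residue A (c • r) := by
    rw [Algebra.smul_def, Algebra.smul_def, map_mul, IsScalarTower.algebraMap_apply k A]
    rfl
  rw [h1, h2, h2, smul_assoc]

/-- With an augmentation `π : A → k`, the residue field of the local `k`-algebra `A` is `k`:
`k → A → A/𝔪_A` is bijective. [folklore] -/
theorem algebraMap_residueField_bijective (π : A →ₐ[k] k) :
    Function.Bijective (algebraMap k (ResidueField A)) := by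
  constructor
  · exact (algebraMap k (ResidueField A)).injective
  · intro x
    obtain ⟨a, rfl⟩ := IsLocalRing.residue_surjective x
    refine ⟨π a, ?_⟩
    rw [IsScalarTower.algebraMap_apply k A (ResidueField A)]
    change Ideal.Quotient.mk (maximalIdeal A) (algebraMap k A (π a)) =
      Ideal.Quotient.mk (maximalIdeal A) a
    rw [Ideal.Quotient.eq, ← ker_eq_maximalIdeal π, RingHom.mem_ker]
    change π (algebraMap k A (π a) - a) = 0
    rw [map_sub, AlgHom.commutes, Algebra.algebraMap_self, RingHom.id_apply, sub_self]

/-- `k ≃ A/𝔪_A` as `k`-vector spaces, for a local augmented `k`-algebra. [folklore] -/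
def residueFieldLinearEquiv (π : A →ₐ[k] k) : k ≃ₗ[k] ResidueField A :=
  LinearEquiv.ofBijective (Algebra.linearMap k (ResidueField A))
    (algebraMap_residueField_bijective π)

/-- **`dim_k 𝔪_A/𝔪_A² = μ(𝔪_A)`** for a local Noetherian augmented `k`-algebra: the residue
field is `k`, and over the residue field this is Nakayama (Mathlib
`IsLocalRing.spanFinrank_maximalIdeal_eq_finrank_cotangentSpace`). [cite: Mazur1997Deformation, §15] -/
theorem finrank_cotangentSpace_eq_spanFinrank [IsNoetherianRing A] (π : A →ₐ[k] k) :
    Module.finrank k (CotangentSpace A) = (maximalIdeal A).spanFinrank := by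
  haveI := isScalarTower_residueField_cotangentSpace (k := k) (A := A)
  let e := residueFieldLinearEquiv π
  haveI : Module.Finite k (ResidueField A) := Module.Finite.equiv e
  have h1 : Module.finrank k (ResidueField A) = 1 := by
    rw [← e.finrank_eq, Module.finrank_self]
  rw [IsLocalRing.spanFinrank_maximalIdeal_eq_finrank_cotangentSpace,
    ← Module.finrank_mul_finrank k (ResidueField A) (CotangentSpace A), h1, one_mul]

/-- **`#t_A = #k ^ μ(𝔪_A)`**: for `k` finite and `A` a local Noetherian augmented `k`-algebra,
the number of `k[ε]`-points lifting the augmentation is `#k` to the minimal number of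
generators of `𝔪_A` ("`dim_k t_R = dim_k 𝔪_R/(𝔪_R², 𝔪_Λ)`", here with `Λ = k`).
[cite: Mazur1997Deformation, §15] [cite: Bockle2007Presentations, Theorem 2.2] -/
theorem natCard_eq_pow_spanFinrank [Finite k] [IsNoetherianRing A] :
    Nat.card (TangentHom π) = Nat.card k ^ (maximalIdeal A).spanFinrank := by
  rw [natCard_eq, ← finrank_cotangentSpace_eq_spanFinrank π]
  congr 1
  exact ((Ideal.Cotangent.equivOfEq _ _ (ker_eq_maximalIdeal π)).restrictScalars k).finrank_eq

end Local

end TangentHom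

end Literature.RingTheory.CompleteLocalRings
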